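import Literature.NumberTheory.DiophantineGeometry.AbcDarmonGranvilleProofs
import HarnessLib

/-!
# Darmon–Granville's Theorem 2 with coefficients (`darmonGranville1995_thm_2`): the elementary steps

`Literature.NumberTheory.DiophantineGeometry.darmonGranville1995_thm_2` (`AbcWave0`) records
Theorem 2 of H. Darmon & A. Granville, *On the equations `z ^ m = F(x, y)` and
`A x ^ p + B y ^ q = C z ^ r`*, Bull. London Math. Soc. **27** (1995) 513–543, as printed (p. 515):
for non-zero integers `A, B, C` and a fixed hyperbolic signature `(p, q, r)`
(`1/p + 1/q + 1/r < 1`, integer test `q r + r p + p q < p q r`) the generalized Fermat equation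
`A x ^ p + B y ^ q = C z ^ r` has only finitely many *proper* integer solutions
(`gcd(x, y, z) = 1`, p. 513). The companion file `AbcDarmonGranvilleProofs` treats the special case
`A = B = C = 1` in positive integers (`darmon_granville`).

The printed proof (§3, pp. 524–527) attaches to a proper solution the parameter
`t := A x ^ p / C z ^ r ∈ ℙ¹(K) ∖ {0, 1, ∞}` (p. 526) and runs: (1) Prop. 3.1 (p. 525, Riemann
existence theorem): a Galois covering `π : X → ℙ¹` of signature `(p, q, r)` over a number field `K`,
of genus `≥ 2` in the hyperbolic case; (2) Prop. 3.2 (p. 526, Beckmann, J. reine angew. Math. **419**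
(1991)): the congruences (3.1) `(t·0)_v ≡ 0 (mod p)`, `(t·1)_v ≡ 0 (mod q)`, `(t·∞)_v ≡ 0 (mod r)`
at `v ∉ V` make `L_t = K(π⁻¹(t))` unramified at `v`; (3) p. 526, last paragraph: "The congruences
in (3.1) are satisfied if `v` does not divide `A`, `B` or `C`"; (4) p. 527: Minkowski
(Hermite–Minkowski) makes the compositum `L` of the `L_t` a number field, Faltings' theorem makes
`X(L)` finite, "Therefore there are only finitely many proper solutions `x, y, z` to (2), as `X(L)`
contains all `d` points of `π⁻¹(A x ^ p / C z ^ r)` for each such solution."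

Steps (1), (2) and the two theorems of (4) are not available in Mathlib or `Literature/` (Faltings'
theorem is the unproved named fact
`Literature.NumberTheory.DiophantineGeometry.finite_algPoints_of_two_le_genus` of `Sweep1`, in the
abstract `SchemeOver` vocabulary; the Riemann existence theorem and Beckmann's ramification
criterion are not stated anywhere), so `darmonGranville1995_thm_2` stays a named fact. This file
proves, sorry-free and without introducing any definition or named fact, the ELEMENTARY steps of the
printed argument for general coefficients, and the bookkeeping the printed proof leaves implicit:

* `Literature.NumberTheory.DiophantineGeometry.darmon_granville_of_darmonGranville1995_thm_2`:
  the record `darmon_granville` (`A = B = C = 1`, pairwise coprime positive solutions) is the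
  special case of the printed theorem;
* `Literature.NumberTheory.DiophantineGeometry.finite_properSolutions_trivial`: the proper
  solutions with `x y z = 0` — for which `t ∈ {0, 1, ∞}` and the descent says nothing — are finitely
  many, by divisibility alone (`|x|, |y|, |z| ≤ |A| + |B| + |C|`), whence the reduction
  `Literature.NumberTheory.DiophantineGeometry.darmonGranville1995_thm_2_iff_nontrivial` of
  Theorem 2 to proper solutions with `x y z ≠ 0`, i.e. with `t ∈ ℙ¹ ∖ {0, 1, ∞}` (p. 526, "Given a
  point `t ∈ ℙ¹(K) ∖ {0, 1, ∞}`");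
* `Literature.NumberTheory.DiophantineGeometry.finite_properSolutions_coeffParam_eq`: for fixed
  `t`, only finitely many proper solutions with `x y z ≠ 0` have parameter `A x ^ p / C z ^ r = t`
  (with coefficients the parameter map is no longer injective — signs, and common factors of `x, z`
  dividing `B` — but `gcd(x, z) ∣ B` and, after removing it, `x ^ p` and `z ^ r` divide fixed
  non-zero integers), whence
  `Literature.NumberTheory.DiophantineGeometry.darmonGranville1995_thm_2_iff_finite_coeffParam_image`:
  Theorem 2 is EQUIVALENT to the finiteness, for all non-zero `A, B, C` and each hyperbolic
  signature, of the set of parameters `t` of proper solutions with `x y z ≠ 0` — exactly what the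
  last paragraph of the printed proof establishes (p. 527);
* `Literature.NumberTheory.DiophantineGeometry.dvd_max_padicValRat_coeff_mul_pow_div` and its three
  instances `…dvd_interZero_coeffParam`, `…dvd_interOne_coeffParam`, `…dvd_interInfty_coeffParam`:
  step (3) over `ℚ` — for a proper solution with `x y z ≠ 0` and a prime `ℓ ∤ A B C` the
  congruences (3.1) hold at `ℓ`: `p ∣ (t·0)_ℓ`, `q ∣ (t·1)_ℓ`, `r ∣ (t·∞)_ℓ`, where
  `(t·0)_ℓ = max(ord_ℓ t, 0)`, `(t·1)_ℓ = max(ord_ℓ (t - 1), 0)`, `(t·∞)_ℓ = max(ord_ℓ (1/t), 0)`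
  (p. 526) and `ord_ℓ` on `ℚ` is Mathlib's `padicValRat ℓ`.

Nothing here changes a statement of `AbcWave0`, and no definition is introduced: the solution set
of `darmonGranville1995_thm_2` and the parameter `t = A x ^ p / C z ^ r` (`coeffParam` in names) are
written out as terms.
-/

namespace Literature.NumberTheory.DiophantineGeometry

/-! ### Properness `gcd(x, y, z) = 1` (p. 513): bookkeeping -/

/-- From `gcd(x, y, z) = 1` (the properness condition of `darmonGranville1995_thm_2`, written
`({x, y, z} : Finset ℤ).gcd id = 1`): every common divisor of `x, y, z` is a unit. [folklore] -/
theorem isUnit_of_dvd_of_gcd_eq_one {x y z d : ℤ} (h : ({x, y, z} : Finset ℤ).gcd id = 1)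
    (hx : d ∣ x) (hy : d ∣ y) (hz : d ∣ z) : IsUnit d := by
  refine isUnit_of_dvd_one (h ▸ Finset.dvd_gcd fun b hb => ?_)
  simp only [Finset.mem_insert, Finset.mem_singleton] at hb
  rcases hb with rfl | rfl | rfl <;> assumption

/-- Two integers are coprime as soon as each of their common divisors is a unit. [folklore] -/
theorem int_isCoprime_of_forall_isUnit {a b : ℤ} (h : ∀ d : ℤ, d ∣ a → d ∣ b → IsUnit d) :
    IsCoprime a b := by
  rw [Int.isCoprime_iff_gcd_eq_one]
  have hu := h _ (Int.gcd_dvd_left a b) (Int.gcd_dvd_right a b)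
  simpa [Int.isUnit_iff_natAbs_eq] using hu

/-- From `gcd(x, y, z) = 1`: two integers `a, b` every common divisor of which divides `x`, `y`
and `z` are coprime (used with `(a, b)` two of the three coordinates, the third divisibility coming
from the equation or from a vanishing coordinate). [folklore] -/
theorem isCoprime_of_gcd_eq_one {x y z a b : ℤ} (h : ({x, y, z} : Finset ℤ).gcd id = 1)
    (hab : ∀ d : ℤ, d ∣ a → d ∣ b → d ∣ x ∧ d ∣ y ∧ d ∣ z) : IsCoprime a b :=
  int_isCoprime_of_forall_isUnit fun d hda hdb =>
    let ⟨hx, hy, hz⟩ := hab d hda hdb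
    isUnit_of_dvd_of_gcd_eq_one h hx hy hz

/-- Pairwise coprime integers (in fact `x, y` coprime suffices) form a proper triple:
`gcd(x, y, z) = 1`. [folklore] -/
theorem gcd_eq_one_of_isCoprime {x y : ℤ} (h : IsCoprime x y) (z : ℤ) :
    ({x, y, z} : Finset ℤ).gcd id = 1 := by
  have hu : IsUnit (({x, y, z} : Finset ℤ).gcd id) :=
    h.isUnit_of_dvd' (Finset.gcd_dvd (f := id) (by simp)) (Finset.gcd_dvd (f := id) (by simp))
  rw [← Finset.normalize_gcd, normalize_eq_one]
  exact hu

/-! ### `darmon_granville` is the special case `A = B = C = 1` of Theorem 2 -/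

/-- **Theorem 2 as printed implies its record `darmon_granville`.** The special case
`A = B = C = 1` of `darmonGranville1995_thm_2`, restricted to positive pairwise coprime solutions
(which are proper), is `darmon_granville` (abc.S18): the coercion `ℕ³ → ℤ³` is injective and maps
the solution set of the latter into that of the former.
[cite: DarmonGranville1995, Theorem 2 (p. 515)] -/
theorem darmon_granville_of_darmonGranville1995_thm_2 (h : darmonGranville1995_thm_2) :
    darmon_granville := by
  intro p q r hpqr
  have hfin := h 1 1 1 one_ne_zero one_ne_zero one_ne_zero hpqr
  refine Set.Finite.of_finite_image (f := fun t : ℕ × ℕ × ℕ => ((t.1 : ℤ), (t.2.1 : ℤ), (t.2.2 : ℤ)))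
    (hfin.subset ?_) ?_
  · rintro _ ⟨⟨x, y, z⟩, ⟨-, -, -, hxy, -, -, he⟩, rfl⟩
    refine ⟨gcd_eq_one_of_isCoprime (Nat.isCoprime_iff_coprime.mpr hxy) _, ?_⟩
    dsimp only
    rw [one_mul, one_mul, one_mul]
    exact_mod_cast he
  · rintro ⟨x, y, z⟩ - ⟨x', y', z'⟩ - he
    simp only [Prod.mk.injEq, Nat.cast_inj] at he
    obtain ⟨rfl, rfl, rfl⟩ := he
    rfl

/-! ### Proper solutions with `x y z = 0` (`t ∈ {0, 1, ∞}`) are finitely many -/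

/-- If `y ^ q` divides a non-zero integer `C` (`q ≠ 0`), then `|y| ≤ |C|`. [folklore] -/
theorem abs_le_of_pow_dvd {y C : ℤ} {q : ℕ} (hq : q ≠ 0) (hC : C ≠ 0) (h : y ^ q ∣ C) :
    |y| ≤ |C| := by
  have h1 : |y ^ q| ≤ |C| := Int.le_of_dvd (abs_pos.mpr hC) ((abs_dvd_abs _ _).mpr h)
  have h2 : |y| ≤ |y ^ q| := by
    rw [abs_pow]
    rcases eq_or_ne y 0 with rfl | hy
    · rw [abs_zero]
      exact pow_nonneg le_rfl q
    · exact le_self_pow₀ (Int.one_le_abs hy) hq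
  exact h2.trans h1

/-- A box `|x|, |y|, |z| ≤ M` in `ℤ³` is finite. [folklore] -/
theorem finite_abs_le_box3 (M : ℤ) : {t : ℤ × ℤ × ℤ | |t.1| ≤ M ∧ |t.2.1| ≤ M ∧ |t.2.2| ≤ M}.Finite := by
  refine ((Set.finite_Icc (-M) M).prod ((Set.finite_Icc (-M) M).prod
    (Set.finite_Icc (-M) M))).subset ?_
  rintro ⟨x, y, z⟩ ⟨hx, hy, hz⟩
  simp only [Set.mem_prod, Set.mem_Icc]
  exact ⟨abs_le.mp hx, abs_le.mp hy, abs_le.mp hz⟩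

/-- **Coprime solutions of a two-term equation are bounded.** If `A u ^ m = B w ^ n` with `A, B`
non-zero, `m, n ≠ 0` and `u, w` coprime, then `u ^ m ∣ B` and `w ^ n ∣ A`, so `|u| ≤ |B|` and
`|w| ≤ |A|`. [folklore] -/
theorem abs_le_of_coprime_of_mul_pow_eq {A B u w : ℤ} {m n : ℕ} (hA : A ≠ 0) (hB : B ≠ 0)
    (hm : m ≠ 0) (hn : n ≠ 0) (huw : IsCoprime u w) (h : A * u ^ m = B * w ^ n) :
    |u| ≤ |B| ∧ |w| ≤ |A| := by
  constructor
  · have hdvd : u ^ m ∣ B * w ^ n := ⟨A, by linear_combination -h⟩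
    exact abs_le_of_pow_dvd hm hB ((IsCoprime.pow (m := m) (n := n) huw).dvd_of_dvd_mul_right hdvd)
  · have hdvd : w ^ n ∣ A * u ^ m := ⟨B, by linear_combination h⟩
    exact abs_le_of_pow_dvd hn hA
      ((IsCoprime.pow (m := n) (n := m) huw.symm).dvd_of_dvd_mul_right hdvd)

/-- **The proper solutions with `x y z = 0` are finitely many** (for all non-zero `A, B, C` and all
non-zero exponents): if `x = 0` then `B y ^ q = C z ^ r` with `y, z` coprime, so `y ^ q ∣ C` and
`z ^ r ∣ B`; similarly for `y = 0` and `z = 0`. Hence all of them lie in the box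
`|x|, |y|, |z| ≤ |A| + |B| + |C|`. (These are the solutions whose parameter `t = A x ^ p / C z ^ r`
is `0`, `1` or `∞`, excluded from the descent of the printed proof, p. 526: "Given a point
`t ∈ ℙ¹(K) ∖ {0, 1, ∞}`".) [cite: DarmonGranville1995, §3, proof of Theorem 2 (pp. 526–527)] -/
theorem finite_properSolutions_trivial {A B C : ℤ} (hA : A ≠ 0) (hB : B ≠ 0) (hC : C ≠ 0)
    {p q r : ℕ} (hp : p ≠ 0) (hq : q ≠ 0) (hr : r ≠ 0) :
    {t : ℤ × ℤ × ℤ | ({t.1, t.2.1, t.2.2} : Finset ℤ).gcd id = 1 ∧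
      A * t.1 ^ p + B * t.2.1 ^ q = C * t.2.2 ^ r ∧ t.1 * t.2.1 * t.2.2 = 0}.Finite := by
  refine (finite_abs_le_box3 (|A| + |B| + |C|)).subset ?_
  rintro ⟨x, y, z⟩ ⟨hg, he, h0⟩
  dsimp only at hg he h0 ⊢
  have hA0 := abs_nonneg A
  have hB0 := abs_nonneg B
  have hC0 := abs_nonneg C
  rcases mul_eq_zero.mp h0 with hxy | rfl
  · rcases mul_eq_zero.mp hxy with rfl | rfl
    · -- `x = 0`: `B y ^ q = C z ^ r` with `y, z` coprime
      rw [zero_pow hp, mul_zero, zero_add] at he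
      have hyz : IsCoprime y z :=
        isCoprime_of_gcd_eq_one hg fun d hdy hdz => ⟨dvd_zero d, hdy, hdz⟩
      obtain ⟨hy, hz⟩ := abs_le_of_coprime_of_mul_pow_eq hB hC hq hr hyz he
      exact ⟨by rw [abs_zero]; positivity, by linarith, by linarith⟩
    · -- `y = 0`: `A x ^ p = C z ^ r` with `x, z` coprime
      rw [zero_pow hq, mul_zero, add_zero] at he
      have hxz : IsCoprime x z :=
        isCoprime_of_gcd_eq_one hg fun d hdx hdz => ⟨hdx, dvd_zero d, hdz⟩
      obtain ⟨hx, hz⟩ := abs_le_of_coprime_of_mul_pow_eq hA hC hp hr hxz he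
      exact ⟨by linarith, by rw [abs_zero]; positivity, by linarith⟩
  · -- `z = 0`: `A x ^ p = (-B) y ^ q` with `x, y` coprime
    rw [zero_pow hr, mul_zero] at he
    have hxy : IsCoprime x y :=
      isCoprime_of_gcd_eq_one hg fun d hdx hdy => ⟨hdx, hdy, dvd_zero d⟩
    obtain ⟨hx, hy⟩ := abs_le_of_coprime_of_mul_pow_eq hA (neg_ne_zero.mpr hB) hp hq hxy
      (by linear_combination he)
    rw [abs_neg] at hx
    exact ⟨by linarith, by linarith, by rw [abs_zero]; positivity⟩

/-- **Theorem 2 reduces to proper solutions with `x y z ≠ 0`** (those with a parameter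
`t = A x ^ p / C z ^ r ∈ ℙ¹ ∖ {0, 1, ∞}`, p. 526): the solution set of `darmonGranville1995_thm_2`
is the union of these and of the finitely many trivial ones (`finite_properSolutions_trivial`).
[cite: DarmonGranville1995, §3, proof of Theorem 2 (pp. 526–527)] -/
theorem darmonGranville1995_thm_2_iff_nontrivial :
    darmonGranville1995_thm_2 ↔
      ∀ (A B C : ℤ), A ≠ 0 → B ≠ 0 → C ≠ 0 → ∀ {p q r : ℕ}, q * r + r * p + p * q < p * q * r →
        {t : ℤ × ℤ × ℤ | ({t.1, t.2.1, t.2.2} : Finset ℤ).gcd id = 1 ∧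
          A * t.1 ^ p + B * t.2.1 ^ q = C * t.2.2 ^ r ∧ t.1 * t.2.1 * t.2.2 ≠ 0}.Finite := by
  constructor
  · intro h A B C hA hB hC p q r hpqr
    exact (h A B C hA hB hC hpqr).subset fun t ht => ⟨ht.1, ht.2.1⟩
  · intro h A B C hA hB hC p q r hpqr
    obtain ⟨hp, hq, hr⟩ := hyperbolic_exponents_ne_zero hpqr
    refine ((h A B C hA hB hC hpqr).union
      (finite_properSolutions_trivial hA hB hC hp hq hr)).subset fun t ht => ?_
    by_cases h0 : t.1 * t.2.1 * t.2.2 = 0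
    · exact Or.inr ⟨ht.1, ht.2, h0⟩
    · exact Or.inl ⟨ht.1, ht.2, h0⟩

/-! ### The parameter `t = A x ^ p / C z ^ r` (p. 526: "take `t = A x ^ p / C z ^ r`") -/

/-- For a solution with `x z ≠ 0` the parameter `t = A x ^ p / C z ^ r` is non-zero.
[cite: DarmonGranville1995, §3, proof of Theorem 2 (p. 526)] -/
theorem coeffParam_ne_zero {A C x z : ℤ} (hA : A ≠ 0) (hC : C ≠ 0) (hx : x ≠ 0) (hz : z ≠ 0)
    (p r : ℕ) : (A : ℚ) * (x : ℚ) ^ p / ((C : ℚ) * (z : ℚ) ^ r) ≠ 0 :=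
  div_ne_zero (mul_ne_zero (Int.cast_ne_zero.mpr hA) (pow_ne_zero _ (Int.cast_ne_zero.mpr hx)))
    (mul_ne_zero (Int.cast_ne_zero.mpr hC) (pow_ne_zero _ (Int.cast_ne_zero.mpr hz)))

/-- For a solution of `A x ^ p + B y ^ q = C z ^ r` with `z ≠ 0` the parameter satisfies
`t - 1 = (-B) y ^ q / C z ^ r` (p. 526). [cite: DarmonGranville1995, §3, proof of Theorem 2 (p. 526)] -/
theorem coeffParam_sub_one {A B C x y z : ℤ} {p q r : ℕ} (hC : C ≠ 0) (hz : z ≠ 0)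
    (he : A * x ^ p + B * y ^ q = C * z ^ r) :
    (A : ℚ) * (x : ℚ) ^ p / ((C : ℚ) * (z : ℚ) ^ r) - 1 =
      ((-B : ℤ) : ℚ) * (y : ℚ) ^ q / ((C : ℚ) * (z : ℚ) ^ r) := by
  have hQ : (C : ℚ) * (z : ℚ) ^ r ≠ 0 :=
    mul_ne_zero (Int.cast_ne_zero.mpr hC) (pow_ne_zero _ (Int.cast_ne_zero.mpr hz))
  rw [div_sub_one hQ]
  congr 1
  have h' : ((A * x ^ p + B * y ^ q : ℤ) : ℚ) = ((C * z ^ r : ℤ) : ℚ) := by exact_mod_cast he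
  push_cast at h' ⊢
  linear_combination h'

/-- For a solution with `y z ≠ 0` (and `B ≠ 0`) the parameter `t = A x ^ p / C z ^ r` is not `1`, so
that for `x y z ≠ 0` it lies in `ℙ¹ ∖ {0, 1, ∞}` (p. 526: "Given a point `t ∈ ℙ¹(K) ∖ {0, 1, ∞}`").
[cite: DarmonGranville1995, §3, proof of Theorem 2 (p. 526)] -/
theorem coeffParam_ne_one {A B C x y z : ℤ} {p q r : ℕ} (hB : B ≠ 0) (hC : C ≠ 0) (hy : y ≠ 0)
    (hz : z ≠ 0) (he : A * x ^ p + B * y ^ q = C * z ^ r) :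
    (A : ℚ) * (x : ℚ) ^ p / ((C : ℚ) * (z : ℚ) ^ r) ≠ 1 := by
  intro h1
  have h0 := coeffParam_sub_one (A := A) (x := x) (p := p) hC hz he
  rw [h1, sub_self] at h0
  exact coeffParam_ne_zero (neg_ne_zero.mpr hB) hC hy hz q r h0.symm

/-! ### Last step (p. 527): finitely many proper solutions share a parameter `t` -/

/-- **The fibres of the parameter map are finite.** For non-zero `A, B, C`, non-zero exponents and a
fixed `t₀ ∈ ℚ`, only finitely many proper solutions `(x, y, z)` of `A x ^ p + B y ^ q = C z ^ r` with
`x y z ≠ 0` have `A x ^ p / C z ^ r = t₀`. Proof: `d := gcd(x, z)` divides `A x ^ p` and `C z ^ r`,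
hence `B y ^ q`, and is prime to `y` by properness, so `d ∣ B`; writing `x = d x₁`, `z = d z₁` with
`x₁, z₁` coprime, the cross-multiplied relation `A x ^ p · den t₀ = num t₀ · C z ^ r` gives
`x₁ ^ p ∣ num t₀ · C · d ^ r` and `z₁ ^ r ∣ A · d ^ p · den t₀`, both non-zero; so `|x|` and `|z|`
are bounded in terms of `A, B, C, t₀`, and then so is `|y| ≤ |B y ^ q| = |C z ^ r - A x ^ p|`. (With
`A = B = C = 1` and positive solutions the map is even injective, `dgParam_injOn` in
`AbcDarmonGranvilleProofs`; with coefficients it is not — signs, and the factor `d ∣ B`.) This is the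
count behind the last sentence of the printed proof: "Therefore there are only finitely many proper
solutions `x, y, z` to (2), as `X(L)` contains all `d` points of `π⁻¹(A x ^ p / C z ^ r)` for each
such solution" (p. 527). [cite: DarmonGranville1995, §3, proof of Theorem 2 (p. 527)] -/
theorem finite_properSolutions_coeffParam_eq {A B C : ℤ} (hA : A ≠ 0) (hB : B ≠ 0) (hC : C ≠ 0)
    {p q r : ℕ} (hp : p ≠ 0) (hq : q ≠ 0) (hr : r ≠ 0) (t₀ : ℚ) :
    {t : ℤ × ℤ × ℤ | ({t.1, t.2.1, t.2.2} : Finset ℤ).gcd id = 1 ∧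
      A * t.1 ^ p + B * t.2.1 ^ q = C * t.2.2 ^ r ∧ t.1 * t.2.1 * t.2.2 ≠ 0 ∧
      (A : ℚ) * (t.1 : ℚ) ^ p / ((C : ℚ) * (t.2.2 : ℚ) ^ r) = t₀}.Finite := by
  -- the box `|x| ≤ X₀`, `|y| ≤ Y₀`, `|z| ≤ Z₀`
  obtain ⟨X₀, hX₀⟩ : ∃ X₀ : ℤ, X₀ = |t₀.num| * |C| * |B| ^ r * |B| := ⟨_, rfl⟩
  obtain ⟨Z₀, hZ₀⟩ : ∃ Z₀ : ℤ, Z₀ = |A| * |B| ^ p * t₀.den * |B| := ⟨_, rfl⟩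
  obtain ⟨Y₀, hY₀⟩ : ∃ Y₀ : ℤ, Y₀ = |C| * Z₀ ^ r + |A| * X₀ ^ p := ⟨_, rfl⟩
  have hX₀0 : 0 ≤ X₀ := by rw [hX₀]; positivity
  have hZ₀0 : 0 ≤ Z₀ := by rw [hZ₀]; positivity
  have hY₀0 : 0 ≤ Y₀ := by rw [hY₀]; positivity
  refine (finite_abs_le_box3 (X₀ + Y₀ + Z₀)).subset ?_
  rintro ⟨x, y, z⟩ ⟨hg, he, h0, ht⟩
  dsimp only at hg he h0 ht ⊢
  have hx : x ≠ 0 := fun h => h0 (by rw [h, zero_mul, zero_mul])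
  have hy : y ≠ 0 := fun h => h0 (by rw [h, mul_zero, zero_mul])
  have hz : z ≠ 0 := fun h => h0 (by rw [h, mul_zero])
  -- the parameter relation, cross-multiplied: `A x ^ p · den t₀ = num t₀ · C z ^ r`, `num t₀ ≠ 0`
  have hQ : (C : ℚ) * (z : ℚ) ^ r ≠ 0 :=
    mul_ne_zero (Int.cast_ne_zero.mpr hC) (pow_ne_zero _ (Int.cast_ne_zero.mpr hz))
  have hPQ : (A : ℚ) * (x : ℚ) ^ p = t₀ * ((C : ℚ) * (z : ℚ) ^ r) := by
    rw [← ht, div_mul_cancel₀ _ hQ]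
  have hnum : t₀.num ≠ 0 := by
    rw [Rat.num_ne_zero, ← ht]
    exact coeffParam_ne_zero hA hC hx hz p r
  have hcross : A * x ^ p * t₀.den = t₀.num * (C * z ^ r) := by
    have h1 : (A : ℚ) * (x : ℚ) ^ p * t₀.den = t₀.num * ((C : ℚ) * (z : ℚ) ^ r) := by
      rw [hPQ, mul_right_comm, Rat.mul_den_eq_num]
    exact_mod_cast h1
  -- `d = gcd(x, z)` divides `B`, hence `d ≤ |B|`
  obtain ⟨d, x₁, z₁, hd, hx₁z₁, hxd, hzd⟩ :=
    Int.exists_gcd_one' (Int.gcd_pos_of_ne_zero_left z hx)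
  have hcop : IsCoprime x₁ z₁ := Int.isCoprime_iff_gcd_eq_one.mpr hx₁z₁
  have hd0 : (0 : ℤ) ≤ d := by positivity
  have hd' : (d : ℤ) ≠ 0 := by exact_mod_cast hd.ne'
  have hdx : (d : ℤ) ∣ x := ⟨x₁, by rw [hxd, mul_comm]⟩
  have hdz : (d : ℤ) ∣ z := ⟨z₁, by rw [hzd, mul_comm]⟩
  have hdB : (d : ℤ) ∣ B := by
    have hdy : IsCoprime (d : ℤ) y :=
      isCoprime_of_gcd_eq_one hg fun e hed hey => ⟨hed.trans hdx, hey, hed.trans hdz⟩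
    refine (IsCoprime.pow_right (n := q) hdy).dvd_of_dvd_mul_right ?_
    have hByq : B * y ^ q = C * z ^ r - A * x ^ p := by linear_combination he
    rw [hByq]
    exact dvd_sub (Dvd.dvd.mul_left (dvd_pow hdz hr) _) (Dvd.dvd.mul_left (dvd_pow hdx hp) _)
  have hdle : (d : ℤ) ≤ |B| := Int.le_of_dvd (abs_pos.mpr hB) ((dvd_abs _ _).mpr hdB)
  -- after removing `d`: `x₁ ^ p ∣ num t₀ · C · d ^ r` and `z₁ ^ r ∣ A · d ^ p · den t₀`
  have hcross' : x₁ ^ p * (A * (d : ℤ) ^ p * t₀.den) = z₁ ^ r * (t₀.num * C * (d : ℤ) ^ r) := by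
    rw [hxd, hzd, mul_pow, mul_pow] at hcross
    linear_combination hcross
  have hx₁ : |x₁| ≤ |t₀.num| * |C| * |B| ^ r := by
    have hdvd : x₁ ^ p ∣ (t₀.num * C * (d : ℤ) ^ r) * z₁ ^ r :=
      ⟨A * (d : ℤ) ^ p * t₀.den, by linear_combination -hcross'⟩
    have hN : t₀.num * C * (d : ℤ) ^ r ≠ 0 := mul_ne_zero (mul_ne_zero hnum hC) (pow_ne_zero _ hd')
    calc |x₁| ≤ |t₀.num * C * (d : ℤ) ^ r| :=
          abs_le_of_pow_dvd hp hN ((IsCoprime.pow hcop).dvd_of_dvd_mul_right hdvd)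
      _ = |t₀.num| * |C| * (d : ℤ) ^ r := by rw [abs_mul, abs_mul, abs_pow, abs_of_nonneg hd0]
      _ ≤ |t₀.num| * |C| * |B| ^ r := by gcongr
  have hz₁ : |z₁| ≤ |A| * |B| ^ p * t₀.den := by
    have hdvd : z₁ ^ r ∣ (A * (d : ℤ) ^ p * t₀.den) * x₁ ^ p :=
      ⟨t₀.num * C * (d : ℤ) ^ r, by linear_combination hcross'⟩
    have hM : A * (d : ℤ) ^ p * t₀.den ≠ 0 :=
      mul_ne_zero (mul_ne_zero hA (pow_ne_zero _ hd')) (by exact_mod_cast t₀.den_nz)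
    calc |z₁| ≤ |A * (d : ℤ) ^ p * t₀.den| :=
          abs_le_of_pow_dvd hr hM ((IsCoprime.pow hcop.symm).dvd_of_dvd_mul_right hdvd)
      _ = |A| * (d : ℤ) ^ p * t₀.den := by
          rw [abs_mul, abs_mul, abs_pow, abs_of_nonneg hd0, Nat.abs_cast]
      _ ≤ |A| * |B| ^ p * t₀.den := by gcongr
  -- the box
  have hxX : |x| ≤ X₀ := by
    rw [hX₀, hxd, abs_mul, Nat.abs_cast]
    exact mul_le_mul hx₁ hdle hd0 (by positivity)
  have hzZ : |z| ≤ Z₀ := by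
    rw [hZ₀, hzd, abs_mul, Nat.abs_cast]
    exact mul_le_mul hz₁ hdle hd0 (by positivity)
  have hyY : |y| ≤ Y₀ := by
    have hByq : B * y ^ q = C * z ^ r - A * x ^ p := by linear_combination he
    calc |y| ≤ |y| ^ q := le_self_pow₀ (Int.one_le_abs hy) hq
      _ ≤ |B| * |y| ^ q := le_mul_of_one_le_left (by positivity) (Int.one_le_abs hB)
      _ = |C * z ^ r - A * x ^ p| := by rw [← hByq, abs_mul, abs_pow]
      _ ≤ |C * z ^ r| + |A * x ^ p| := abs_sub _ _
      _ = |C| * |z| ^ r + |A| * |x| ^ p := by rw [abs_mul, abs_mul, abs_pow, abs_pow]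
      _ ≤ |C| * Z₀ ^ r + |A| * X₀ ^ p := by gcongr
      _ = Y₀ := hY₀.symm
  exact ⟨by linarith, by linarith, by linarith⟩

/-- **Theorem 2 ⇔ finitely many parameters.** Darmon–Granville's Theorem 2 as printed
(`darmonGranville1995_thm_2`) is equivalent to: for all non-zero `A, B, C` and each hyperbolic
signature `(p, q, r)`, the set of parameters `t = A x ^ p / C z ^ r ∈ ℚ` of the proper solutions with
`x y z ≠ 0` is finite. The printed proof (p. 527) establishes exactly the latter — every such `t` has
its fibre `π⁻¹(t)` inside the finite set `X(L)` — and concludes by this equivalence: `←` is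
`finite_properSolutions_coeffParam_eq` (finite fibres) with `finite_properSolutions_trivial`
(the solutions with `x y z = 0`), `→` is trivial.
[cite: DarmonGranville1995, Theorem 2 (p. 515) and §3, proof of Theorem 2 (p. 527)] -/
theorem darmonGranville1995_thm_2_iff_finite_coeffParam_image :
    darmonGranville1995_thm_2 ↔
      ∀ (A B C : ℤ), A ≠ 0 → B ≠ 0 → C ≠ 0 → ∀ {p q r : ℕ}, q * r + r * p + p * q < p * q * r →
        ((fun t : ℤ × ℤ × ℤ => (A : ℚ) * (t.1 : ℚ) ^ p / ((C : ℚ) * (t.2.2 : ℚ) ^ r)) ''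
          {t : ℤ × ℤ × ℤ | ({t.1, t.2.1, t.2.2} : Finset ℤ).gcd id = 1 ∧
            A * t.1 ^ p + B * t.2.1 ^ q = C * t.2.2 ^ r ∧ t.1 * t.2.1 * t.2.2 ≠ 0}).Finite := by
  rw [darmonGranville1995_thm_2_iff_nontrivial]
  constructor
  · intro h A B C hA hB hC p q r hpqr
    exact (h A B C hA hB hC hpqr).image _
  · intro h A B C hA hB hC p q r hpqr
    obtain ⟨hp, hq, hr⟩ := hyperbolic_exponents_ne_zero hpqr
    refine ((h A B C hA hB hC hpqr).biUnion fun v _ =>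
      finite_properSolutions_coeffParam_eq hA hB hC hp hq hr v).subset fun t ht => ?_
    exact Set.mem_biUnion (Set.mem_image_of_mem _ ht) ⟨ht.1, ht.2.1, ht.2.2, rfl⟩

/-! ### The congruences (3.1) at every prime `ℓ ∤ A B C` (Prop. 3.2 hypothesis; p. 526) -/

/-- In a proper solution of `A x ^ p + B y ^ q = C z ^ r` (`p, r ≠ 0`), a prime `ℓ ∤ B` does not
divide both `x` and `z`: it would divide `B y ^ q`, hence `y`, hence `gcd(x, y, z) = 1`. [folklore] -/
theorem not_dvd_and_dvd_of_proper {ℓ : ℤ} (hℓ : Prime ℓ) {A B C x y z : ℤ} {p q r : ℕ} (hp : p ≠ 0)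
    (hr : r ≠ 0) (hB : ¬ ℓ ∣ B) (hg : ({x, y, z} : Finset ℤ).gcd id = 1)
    (he : A * x ^ p + B * y ^ q = C * z ^ r) : ¬ (ℓ ∣ x ∧ ℓ ∣ z) := by
  rintro ⟨hx, hz⟩
  have hByq : ℓ ∣ B * y ^ q := by
    have h' : B * y ^ q = C * z ^ r - A * x ^ p := by linear_combination he
    rw [h']
    exact dvd_sub (Dvd.dvd.mul_left (dvd_pow hz hr) _) (Dvd.dvd.mul_left (dvd_pow hx hp) _)
  have hy : ℓ ∣ y := hℓ.dvd_of_dvd_pow ((hℓ.dvd_or_dvd hByq).resolve_left hB)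
  exact hℓ.not_unit (isUnit_of_dvd_of_gcd_eq_one hg hx hy hz)

/-- **The local computation behind (3.1).** Let `ℓ` be a prime, `a, b` integers prime to `ℓ`, and
`u, w` non-zero integers not both divisible by `ℓ`. Then the "arithmetic intersection number"
`max(ord_ℓ (a u ^ m / b w ^ n), 0)` is divisible by `m`: it equals `m · ord_ℓ u` if `ℓ ∤ w`, and `0`
if `ℓ ∣ w` (then `ℓ ∤ u` and `ord_ℓ (a u ^ m / b w ^ n) = - n · ord_ℓ w ≤ 0`). [folklore] -/
theorem dvd_max_padicValRat_coeff_mul_pow_div {ℓ : ℕ} [Fact ℓ.Prime] {a b u w : ℤ}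
    (ha : ¬ (ℓ : ℤ) ∣ a) (hb : ¬ (ℓ : ℤ) ∣ b) (hu : u ≠ 0) (hw : w ≠ 0)
    (huw : ¬ ((ℓ : ℤ) ∣ u ∧ (ℓ : ℤ) ∣ w)) (m n : ℕ) :
    (m : ℤ) ∣ max (padicValRat ℓ ((a : ℚ) * (u : ℚ) ^ m / ((b : ℚ) * (w : ℚ) ^ n))) 0 := by
  have ha0 : a ≠ 0 := fun h => ha (h ▸ dvd_zero _)
  have hb0 : b ≠ 0 := fun h => hb (h ▸ dvd_zero _)
  have ha' : (a : ℚ) ≠ 0 := Int.cast_ne_zero.mpr ha0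
  have hb' : (b : ℚ) ≠ 0 := Int.cast_ne_zero.mpr hb0
  have hu' : (u : ℚ) ≠ 0 := Int.cast_ne_zero.mpr hu
  have hw' : (w : ℚ) ≠ 0 := Int.cast_ne_zero.mpr hw
  have hv : padicValRat ℓ ((a : ℚ) * (u : ℚ) ^ m / ((b : ℚ) * (w : ℚ) ^ n)) =
      m * padicValInt ℓ u - n * padicValInt ℓ w := by
    rw [padicValRat.div (mul_ne_zero ha' (pow_ne_zero _ hu')) (mul_ne_zero hb' (pow_ne_zero _ hw')),
      padicValRat.mul ha' (pow_ne_zero _ hu'), padicValRat.mul hb' (pow_ne_zero _ hw'),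
      padicValRat.pow, padicValRat.pow, padicValRat.of_int, padicValRat.of_int,
      padicValRat.of_int, padicValRat.of_int, padicValInt.eq_zero_of_not_dvd ha,
      padicValInt.eq_zero_of_not_dvd hb]
    push_cast
    ring
  rw [hv]
  by_cases hlw : (ℓ : ℤ) ∣ w
  · have hlu : ¬ (ℓ : ℤ) ∣ u := fun hlu => huw ⟨hlu, hlw⟩
    have h0 : (0 : ℤ) ≤ n * padicValInt ℓ w := by positivity
    rw [padicValInt.eq_zero_of_not_dvd hlu, Nat.cast_zero, mul_zero, zero_sub,
      max_eq_right (neg_nonpos.mpr h0)]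
    exact dvd_zero _
  · have h0 : (0 : ℤ) ≤ m * padicValInt ℓ u := by positivity
    rw [padicValInt.eq_zero_of_not_dvd hlw, Nat.cast_zero, mul_zero, sub_zero, max_eq_left h0]
    exact dvd_mul_right _ _

/-- A prime not dividing `A B C` divides none of `A`, `B`, `C`. [folklore] -/
theorem not_dvd_of_not_dvd_mul_three {ℓ A B C : ℤ} (h : ¬ ℓ ∣ A * B * C) :
    ¬ ℓ ∣ A ∧ ¬ ℓ ∣ B ∧ ¬ ℓ ∣ C :=
  ⟨fun hA => h ((hA.mul_right _).mul_right _), fun hB => h ((hB.mul_left _).mul_right _),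
    fun hC => h (hC.mul_left _)⟩

/-- **(3.1) at `0`.** For a proper solution of `A x ^ p + B y ^ q = C z ^ r` with `x z ≠ 0` and a
prime `ℓ ∤ A B C`, the parameter `t = A x ^ p / C z ^ r` has `p ∣ (t·0)_ℓ := max(ord_ℓ t, 0)` (it is
`p · ord_ℓ x` if `ℓ ∤ z` and `0` otherwise). This is "The congruences in (3.1) are satisfied if `v`
does not divide `A`, `B` or `C`" (p. 526), at `0`.
[cite: DarmonGranville1995, §3, (3.1) and proof of Theorem 2 (p. 526)] -/
theorem dvd_interZero_coeffParam {ℓ : ℕ} [Fact ℓ.Prime] {A B C x y z : ℤ} {p q r : ℕ}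
    (hp : p ≠ 0) (hr : r ≠ 0) (hℓ : ¬ (ℓ : ℤ) ∣ A * B * C)
    (hg : ({x, y, z} : Finset ℤ).gcd id = 1) (he : A * x ^ p + B * y ^ q = C * z ^ r)
    (hx : x ≠ 0) (hz : z ≠ 0) :
    (p : ℤ) ∣ max (padicValRat ℓ ((A : ℚ) * (x : ℚ) ^ p / ((C : ℚ) * (z : ℚ) ^ r))) 0 := by
  have hprime : Prime (ℓ : ℤ) := Nat.prime_iff_prime_int.mp Fact.out
  obtain ⟨hA, hB, hC⟩ := not_dvd_of_not_dvd_mul_three hℓ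
  exact dvd_max_padicValRat_coeff_mul_pow_div hA hC hx hz
    (not_dvd_and_dvd_of_proper hprime hp hr hB hg he) p r

/-- **(3.1) at `1`.** For a proper solution of `A x ^ p + B y ^ q = C z ^ r` with `y z ≠ 0` and a
prime `ℓ ∤ A B C`, the parameter `t = A x ^ p / C z ^ r` has `q ∣ (t·1)_ℓ := max(ord_ℓ (t - 1), 0)`
(because `t - 1 = (-B) y ^ q / C z ^ r`, `coeffParam_sub_one`).
[cite: DarmonGranville1995, §3, (3.1) and proof of Theorem 2 (p. 526)] -/
theorem dvd_interOne_coeffParam {ℓ : ℕ} [Fact ℓ.Prime] {A B C x y z : ℤ} {p q r : ℕ}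
    (hq : q ≠ 0) (hr : r ≠ 0) (hℓ : ¬ (ℓ : ℤ) ∣ A * B * C)
    (hg : ({x, y, z} : Finset ℤ).gcd id = 1) (he : A * x ^ p + B * y ^ q = C * z ^ r)
    (hy : y ≠ 0) (hz : z ≠ 0) :
    (q : ℤ) ∣ max (padicValRat ℓ ((A : ℚ) * (x : ℚ) ^ p / ((C : ℚ) * (z : ℚ) ^ r) - 1)) 0 := by
  have hprime : Prime (ℓ : ℤ) := Nat.prime_iff_prime_int.mp Fact.out
  obtain ⟨hA, hB, hC⟩ := not_dvd_of_not_dvd_mul_three hℓ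
  have hC0 : C ≠ 0 := fun h => hC (h ▸ dvd_zero _)
  rw [coeffParam_sub_one hC0 hz he]
  have hg' : ({y, x, z} : Finset ℤ).gcd id = 1 := by rwa [Finset.insert_comm]
  exact dvd_max_padicValRat_coeff_mul_pow_div (fun h => hB (dvd_neg.mp h)) hC hy hz
    (not_dvd_and_dvd_of_proper hprime hq hr hA hg'
      (show B * y ^ q + A * x ^ p = C * z ^ r by rw [add_comm]; exact he)) q r

/-- **(3.1) at `∞`.** For a proper solution of `A x ^ p + B y ^ q = C z ^ r` with `x z ≠ 0` and a
prime `ℓ ∤ A B C`, the parameter `t = A x ^ p / C z ^ r` has `r ∣ (t·∞)_ℓ := max(ord_ℓ (1 / t), 0)`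
(`1 / t = C z ^ r / A x ^ p`). [cite: DarmonGranville1995, §3, (3.1) and proof of Theorem 2 (p. 526)] -/
theorem dvd_interInfty_coeffParam {ℓ : ℕ} [Fact ℓ.Prime] {A B C x y z : ℤ} {p q r : ℕ}
    (hp : p ≠ 0) (hr : r ≠ 0) (hℓ : ¬ (ℓ : ℤ) ∣ A * B * C)
    (hg : ({x, y, z} : Finset ℤ).gcd id = 1) (he : A * x ^ p + B * y ^ q = C * z ^ r)
    (hx : x ≠ 0) (hz : z ≠ 0) :
    (r : ℤ) ∣ max (padicValRat ℓ (1 / ((A : ℚ) * (x : ℚ) ^ p / ((C : ℚ) * (z : ℚ) ^ r)))) 0 := by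
  have hprime : Prime (ℓ : ℤ) := Nat.prime_iff_prime_int.mp Fact.out
  obtain ⟨hA, hB, hC⟩ := not_dvd_of_not_dvd_mul_three hℓ
  rw [one_div_div]
  exact dvd_max_padicValRat_coeff_mul_pow_div hC hA hz hx
    (fun h => not_dvd_and_dvd_of_proper hprime hp hr hB hg he ⟨h.2, h.1⟩) r p

/-- **The congruences (3.1) hold at every prime `ℓ ∤ A B C`** for the parameter
`t = A x ^ p / C z ^ r` of a proper solution of `A x ^ p + B y ^ q = C z ^ r` with `x y z ≠ 0` and
non-zero exponents: `p ∣ (t·0)_ℓ`, `q ∣ (t·1)_ℓ`, `r ∣ (t·∞)_ℓ` — "The congruences in (3.1) are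
satisfied if `v` does not divide `A`, `B` or `C`, and so, by Proposition 3.2, `L_t` is unramified at
any `v ∉ V_{ABC}`" (p. 526; here over `K = ℚ`, `v = ℓ`, `ord_ℓ = padicValRat ℓ`).
[cite: DarmonGranville1995, §3, proof of Theorem 2 (pp. 526–527)] -/
theorem dvd_inter_coeffParam {ℓ : ℕ} [Fact ℓ.Prime] {A B C x y z : ℤ} {p q r : ℕ}
    (hp : p ≠ 0) (hq : q ≠ 0) (hr : r ≠ 0) (hℓ : ¬ (ℓ : ℤ) ∣ A * B * C)
    (hg : ({x, y, z} : Finset ℤ).gcd id = 1) (he : A * x ^ p + B * y ^ q = C * z ^ r)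
    (hx : x ≠ 0) (hy : y ≠ 0) (hz : z ≠ 0) :
    (p : ℤ) ∣ max (padicValRat ℓ ((A : ℚ) * (x : ℚ) ^ p / ((C : ℚ) * (z : ℚ) ^ r))) 0 ∧
      (q : ℤ) ∣ max (padicValRat ℓ ((A : ℚ) * (x : ℚ) ^ p / ((C : ℚ) * (z : ℚ) ^ r) - 1)) 0 ∧
      (r : ℤ) ∣ max (padicValRat ℓ (1 / ((A : ℚ) * (x : ℚ) ^ p / ((C : ℚ) * (z : ℚ) ^ r)))) 0 :=
  ⟨dvd_interZero_coeffParam hp hr hℓ hg he hx hz, dvd_interOne_coeffParam hq hr hℓ hg he hy hz,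
    dvd_interInfty_coeffParam hp hr hℓ hg he hx hz⟩

end Literature.NumberTheory.DiophantineGeometry
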